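import Literature.MathematicalPhysics.QuantumFieldTheory.OSData
import HarnessLib

/-!
# Källén–Lehmann positivity of the truncated two-point Schwinger function (named fact)

For Osterwalder–Schrader data `T : OSData ι d` (Schwinger functions on `⁰𝒮` with E0, E0', E1–E4 as
fields, `Literature.MathematicalPhysics.QuantumFieldTheory.OSData`) and a hermitian scalar species `s`
whose field is not a c-number (`T.IsNontrivial s`), the truncated two-point Schwinger function of
`φ_s` is STRICTLY POSITIVE on non-negative test functions: `𝔖₂^T(f ⊗ g) > 0` whenever `f, g ≥ 0` are
real, not identically zero, and `f ⊗ g ∈ ⁰𝒮` (vanishes with all derivatives on the diagonal).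

Why it is true (the classical chain, NOT formalised here): OS reconstruction [OS 1973/1975, Thm. E→R]
gives a Wightman two-point function `W₂`, whose Fourier transform in the difference variable is a
positive measure supported in the closed forward cone (Wightman positivity + spectral condition), and
Lorentz invariance (from Euclidean rotation invariance E1 under the analytic continuation) turns it
into the Källén–Lehmann form `W₂ = ∫ dρ(m²) Δ⁺_m` with `dρ` a positive tempered measure
[Glimm–Jaffe, *Quantum Physics* (2nd ed.), Thm. 6.2.4, stated for non-Gaussian theories]; continued
back, the truncated Schwinger two-point function is the kernel `S₂^T(x − y) = ∫ dρ(m²) C_m(|x − y|)`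
off the diagonal [ibid. (6.2.9)], `C_m = (−Δ + m²)⁻¹(x, y) > 0` pointwise (`m/(4π²|x|) K₁(m|x|)` in
`d = 4`, `1/(4π²|x|²)` at `m = 0`), with at most polynomial blow-up at the diagonal (temperedness of
`dρ`), so that its pairing with a test function of `⁰𝒮₂` is the absolutely convergent integral
`∬ F(x,y) S₂^T(x−y)`; `dρ ≠ 0` exactly when the truncated two-point function is not identically zero,
which `IsNontrivial` provides (E4 removes the vacuum contribution, i.e. the truncation). Hence for
`f, g ≥ 0` continuous and non-zero the integrand `f(x) g(y) S₂^T(x−y)` is `≥ 0` and `> 0` on an open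
set: `𝔖₂^T(f ⊗ g) > 0`.

What is NOT here: a proof. The tree's OS reconstruction is the E1-free one
(`OSReconstructionNoE1`, joint spectral measure of `(H, P⃗)`: `exists_isJointSpectralMeasure_holds`),
which yields `H ≥ 0` but not the relativistic spectral condition / Lorentz covariance that the
Källén–Lehmann form needs (OS's analytic continuation of the rotations). Discharging this fact
(`theorem KallenLehmannPositivity_holds`) is literature-prover work of that size.

Consumer: crux `ContinuumLegGivenGap` (stmt-QuantumFields-15828), line `duality-selection-nlo-skewness`,
stub `stub_twoPointPositivity` (an eventual lattice two-point floor from the positivity of every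
subsequential OS limit).
-/

open scoped SchwartzMap
open Literature.MathematicalPhysics.AQFT Literature.MathematicalPhysics.QuantumLattice

noncomputable section

namespace Literature.MathematicalPhysics.QuantumFieldTheory

/-- **Källén–Lehmann positivity (named fact).** For OS data `T` on `ℝ^d` and a species `s` with
`T.IsNontrivial s` (the field `φ_s` is not a c-number), and for real non-negative, not identically
zero one-point test functions `f, g` whose tensor product `F₂ = f ⊗ g` lies in `⁰𝒮₂` (with `Ff = [f]`,
`Fg = [g]` the one-point tensors), the TRUNCATED two-point Schwinger function is strictly positive:
`Re (𝔖₂^{ss}(F₂) − 𝔖₁^{s}(Ff) 𝔖₁^{s}(Fg)) > 0`. Informal statement: the Euclidean two-point function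
of a non-trivial hermitian scalar OS field is `∫ dρ(m²) C_m(x − y)` off the diagonal with `dρ ≥ 0`,
`dρ ≠ 0`, `C_m > 0` pointwise (Källén–Lehmann / Umezawa–Kamefuchi spectral representation through OS
reconstruction), hence positive on non-negative non-zero test functions. Glimm–Jaffe 1987, Thm. 6.2.4
with (6.2.9) (Lehmann spectral formula, "valid for non-Gaussian measures"); Osterwalder–Schrader
1973/1975, Thm. E→R (reconstruction supplying the Wightman two-point function, spectral condition and
Lorentz invariance); the Wightman-side statement is Reed–Simon II, Thm. IX.34 (Källén–Lehmann
representation of the two-point function of a hermitian scalar field).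
[cite: GlimmJaffe1987, Thm. 6.2.4 and (6.2.9)] [cite: ReedSimonII1975, Thm. IX.34] [cite: OsterwalderSchrader1975, Thm. E→R] -/
def KallenLehmannPositivity : Prop :=
  ∀ (ι : Type) (d : ℕ) [NeZero d] (T : OSData ι d) (s : ι), T.IsNontrivial s →
    ∀ (f g : 𝓢(EuclideanSpace ℝ (Fin d), ℂ)) (F₂ : 𝓢((Fin 2 → EuclideanSpace ℝ (Fin d)), ℂ))
      (Ff Fg : 𝓢((Fin 1 → EuclideanSpace ℝ (Fin d)), ℂ)),
      IsTensorOf F₂ ![f, g] → IsOffDiagonal F₂ → IsTensorOf Ff ![f] → IsTensorOf Fg ![g] →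
      (∀ x, (f x).im = 0 ∧ 0 ≤ (f x).re ∧ (g x).im = 0 ∧ 0 ≤ (g x).re) → f ≠ 0 → g ≠ 0 →
      0 < (T.schwinger 2 (fun _ => s) F₂ -
        T.schwinger 1 (fun _ => s) Ff * T.schwinger 1 (fun _ => s) Fg).re

end Literature.MathematicalPhysics.QuantumFieldTheory

end
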